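import Literature.AlgebraicGeometry.PlaneCurves.HessePencilHessian
import HarnessLib

/-!
# The Hessian curve is the locus of points whose polar conic is singular (Dolgachev–Kanev §3; Artebani–Dolgachev §3)

Topic `Literature/AlgebraicGeometry/PlaneCurves`, namespace `Literature.AlgebraicGeometry.PlaneCurves`.
Lane `lit-hodgefound`, seat `lit-hodgefound-p37`, row g18-#2; a one-file sequel of
`HessianFlexCriterion` (g15-#1: the Hessian matrix `hessianMatrix F = (∂²F/∂Xᵢ∂Xⱼ)`, Euler's
formulas, `H(p)·p = (n − 1)∇F(p)`, `H_F(p) = det H(p)`) and `HessePencilHessian` (g17-#8: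
`He(H_μ) = −54μ²(X³ + Y³ + Z³) + (216 − 54μ³)XYZ`).  Everything here is PROVED; no definition,
no named fact.

Sources followed.

* I. Dolgachev, V. Kanev, *Polar covariants of plane cubics and quartics*, Adv. Math. 98 (1993)
  216–301 [fetched `galaxy-pdf-699664480` p0009–p0010, p0018], §3 and (5.2.1), VERBATIM:
  > (3.1) […] With each `v ∈ V` one associates a symmetric bilinear form `H(v)` defined by
  > `H(v)(a, b) = F̃(a, b, v, …, v)` […] we obtain a polynomial function on `V` of degree
  > `(r+1)(n−2)`. It is called the Hessian of `F`, and is denoted by `He(F)`. By definition,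
  > `He(F)(v) = 0 ⇔ H(v)` is degenerate `⇔ F̃(a, x, v, …, v) = 0` for some `a ∈ V` and any `x ∈ V`.
  > In coordinates, the matrix of `H(v)` […] is equal to `‖(1/n(n−1)) ∂²F/∂xᵢ∂xⱼ (v)‖`, and the
  > Hessian is equal to the functional determinant `(n² − n)^{−r−1} det ‖∂²F/∂xᵢ∂xⱼ‖`.
  > (3.3) LEMMA. […] The following properties are equivalent: (i) `v` is a singular point of `F`;
  > […] (v) `v` is a singular point of `P_v(F)`.
  > (3.4) PROPOSITION. Let `v ∈ V`. The following properties are equivalent: (i) `He(F)(v) = 0`;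
  > […] (iii) the polar quadric `P_{v^{n−2}}(F)` is singular; (iv) there exists `a ∈ ℙ` such that
  > the hypersurface `P_a(F)` has a singular point at `v` […]
  > (5.2.1) The Hessian `He(F)` of a cubic hypersurface is equal to its Steinerian `St(F)`. This
  > immediately follows from Proposition (3.4). The Steiner correspondence
  > `X(F) = {(a, b) : P_{a,b}(F) = 0}` is symmetric. In other words,
  > `b ∈ Sing(P_a(F)) ⇔ a ∈ Sing(P_b(F))`. By Lemma (3.3), the Steiner correspondence `X(F)` has
  > no united points (i.e., points on the diagonal) if and only if `F` is a non-singular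
  > hypersurface.
* M. Artebani, I. Dolgachev, *The Hesse pencil of plane cubic curves*, Enseign. Math. 55 (2009)
  [held `paper:arxiv-math_0611590` p0006 L1–L3, L33–L35], §3:
  > The first polar of a plane curve `E` with equation `F = 0` with respect to a point
  > `q = (a, b, c) ∈ ℙ²` is the curve `P_q(E)` defined by `aF′_x + bF′_y + cF′_z = 0`. It is easy to
  > see that the Hessian curve `He(E)` of a plane cubic `E` coincides with the locus of points `q`
  > such that the polar conic `P_q(E) = 0` is reducible. […] we write the equation of the polar
  > conic `P_q(E_{6μ})` with respect to a point `q = (u, v, w)`: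
  > `u(x² + 2μyz) + v(y² + 2μxz) + w(z² + 2μxy) = 0.`

## Dictionary

* `F : MvPolynomial (Fin m) K` homogeneous of degree `3` (a cubic form; `m = 3` for plane cubics);
  the first polar with respect to `q : Fin m → K` is WRITTEN OUT as `P_q(F) = Σᵢ qᵢ ∂ᵢF`
  (`∑ i, C (q i) * pderiv i F`; Kunz's `D_q F`, Dolgachev–Kanev's `P_q(F)` up to the factor `1/n`);
  no definition is introduced.
* "the polar conic `P_q(F)` is singular" = it has a singular point: a `s ≠ 0` with
  `∇(P_q F)(s) = 0` (for `2 ≠ 0` such an `s` lies on the conic, `eval_polar_of_grad_eq_zero`);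
  "`P_q(F)` is reducible" = `P_q(F) = ℓ₁ℓ₂` with `ℓ₁, ℓ₂` linear forms (homogeneous of degree `1`).
* `He(F)(q) = eval q (hessianMatrix F).det` (the tree's `hessianMatrix`, Kunz's `H_F`).

## What is here

* §1 Linear forms: a form of degree `0` is a constant (`eq_C_of_isHomogeneous_zero`), a linear
  form is `Σ cᵢXᵢ` with `cᵢ = ∂ᵢℓ` (`eq_sum_C_mul_X_of_isHomogeneous_one`), and its polar is the
  constant `ℓ(q)` (`polar_of_isHomogeneous_one`).
* §2 **The Hessian matrix of the polar conic of a cubic is the Hessian matrix of the cubic AT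
  THE POLE**: `hessianMatrix_polar` — `Hess(P_q F) = (∂ᵢ∂ⱼF(q))ᵢⱼ` (constant entries), hence
  `det_hessianMatrix_polar` — `det Hess(P_q F) = He(F)(q)` ("`H(v)(a, b) = F̃(a, b, v)`": the
  symmetric bilinear form of the polar quadric at `v` is the Hessian form at `v`).
* §3 **Dolgachev–Kanev (3.4) (i) ⇔ (iii) for cubics = Artebani–Dolgachev's sentence**:
  `grad_polar_eq_mulVec` — `∇(P_q F)(s) = H_F(q)·s`; **`eval_det_hessianMatrix_eq_zero_iff_polar_singular`**
  — `He(F)(q) = 0` IFF the polar conic `P_q(F)` has a singular point `s ≠ 0`; `eval_polar_of_grad_eq_zero`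
  (`2·P_qF(s) = ⟨s, ∇P_qF(s)⟩`, so the singular point lies on the conic when `2 ≠ 0`).
  **(5.2.1), the Steiner correspondence of a cubic is symmetric**: `grad_polar_comm` —
  `∇(P_a F)(b) = ∇(P_b F)(a)` (`= H_F(a)·b = H_F(b)·a`), i.e. `b ∈ Sing(P_a(F)) ⇔ a ∈ Sing(P_b(F))`;
  and **(3.3) (i) ⇔ (v) / "no united points iff non-singular"**: `grad_polar_self` —
  `∇(P_v F)(v) = 2∇F(v)`, so (`2 ≠ 0`) `v` is a singular point of its own polar conic iff `v` is
  a singular point of `F` (`grad_polar_self_eq_zero_iff`).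
* §4 **"reducible ⟹ on the Hessian"** (the implication of Artebani–Dolgachev's "reducible"
  formulation that holds over every field): `hessianMatrix_mul_of_grad_eq_C` —
  `Hess(ℓ₁ℓ₂) = a bᵀ + b aᵀ` for linear forms with (constant) gradients `a`, `b`;
  `det_hessianMatrix_mul_linear` — its determinant vanishes (`m = 3`); hence
  **`eval_det_hessianMatrix_eq_zero_of_polar_reducible`**: if `P_q(F) = ℓ₁ℓ₂` then `He(F)(q) = 0`.
  (The converse "singular conic ⟹ pair of lines" needs `K` algebraically closed with `2 ≠ 0` and
  is NOT claimed; §3 is the equivalent "singular" form valid over any field.)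
* §5 **The Hesse pencil**: `hesse_polar` — `P_q(H_μ) = 3[u(X² − μYZ) + v(Y² − μXZ) + w(Z² − μXY)]`
  for `q = (u, v, w)` (the printed `u(x² + 2μ′yz) + …` of `E_{6μ′}`, `μ′ = −μ/2`);
  `hessianMatrix_hesse_polar` — its Hessian matrix `[[6u, −3μw, −3μv], [−3μw, 6v, −3μu],
  [−3μv, −3μu, 6w]]` (the printed symmetric matrix `[[u, 2μ′w, 2μ′v], …]` times `6`);
  **`det_hessianMatrix_hesse_polar`** — `det = −54μ²(u³ + v³ + w³) + (216 − 54μ³)uvw = He(H_μ)(q)`,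
  so that (`hesse_polar_singular_iff`) the polar conic of `q` is singular iff `q` lies on the
  Hessian member `He(H_μ)` of the pencil.

## References
* [DolgachevKanev1993] I. Dolgachev, V. Kanev, *Polar covariants of plane cubics and quartics*,
  Adv. Math. 98 (1993) 216–301, §3 (3.1), Lemma (3.3), Prop. (3.4), (5.2.1).
* [ArtebaniDolgachev2009] M. Artebani, I. Dolgachev, *The Hesse pencil of plane cubic curves*,
  Enseign. Math. (2) 55 (2009) 235–273, §3 (first polars, `He(E)` and reducible polar conics, the
  polar conic of `E_{6μ}`).
* [Kunz2005PlaneAlgebraicCurves] E. Kunz, *Introduction to Plane Algebraic Curves*, Birkhäuser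
  2005, Ch. 9, Def. 9.1 (the polar `D_P F = Σ pᵢ ∂F/∂Xᵢ`).
-/

set_option autoImplicit false

open MvPolynomial Matrix
open Literature.AlgebraicGeometry.HodgeTheory (hessianMatrix hessianMatrix_apply)

namespace Literature.AlgebraicGeometry.PlaneCurves

universe u

/-- The Hesse cubic `H_μ = X³ + Y³ + Z³ − 3μXYZ` (local notation as in the statements of
`HessePencilWeierstrassForm`, no definition). -/
local notation3 "𝐇[" μ "]" =>
  (X 0 ^ 3 + X 1 ^ 3 + X 2 ^ 3 - C (3 * μ) * (X 0 * X 1 * X 2) : MvPolynomial (Fin 3) _)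

section PolarConic

variable {K : Type u} [Field K] {m : ℕ}

/-! ## §1 Forms of degree `0` and `1` -/

/-- A form of degree `0` is a constant. [folklore] -/
private theorem eq_C_of_isHomogeneous_zero {G : MvPolynomial (Fin m) K} (hG : G.IsHomogeneous 0) :
    G = C (coeff 0 G) :=
  totalDegree_eq_zero_iff_eq_C.1 (Nat.le_zero.1 hG.totalDegree_le)

/-- A linear form is `Σᵢ cᵢXᵢ` with `cᵢ` the constant `∂ᵢℓ` (Euler's formula in degree `1`).
[cite: DolgachevKanev1993, §3 (3.1) (polarization of forms)] -/
theorem eq_sum_C_mul_X_of_isHomogeneous_one {ℓ : MvPolynomial (Fin m) K} (hℓ : ℓ.IsHomogeneous 1) :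
    ℓ = ∑ i, C (coeff 0 (pderiv i ℓ)) * X i := by
  conv_lhs => rw [← one_smul ℕ ℓ, ← hℓ.sum_X_mul_pderiv]
  refine Finset.sum_congr rfl fun i _ => ?_
  rw [mul_comm, ← eq_C_of_isHomogeneous_zero hℓ.pderiv]

/-- The polar of a linear form `ℓ` with respect to `q` is the constant `ℓ(q)`:
`Σᵢ qᵢ ∂ᵢℓ = ℓ(q)`. [cite: DolgachevKanev1993, §3 (3.1) (polarization of forms)] -/
theorem polar_of_isHomogeneous_one {ℓ : MvPolynomial (Fin m) K} (hℓ : ℓ.IsHomogeneous 1)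
    (q : Fin m → K) : ∑ i, C (q i) * pderiv i ℓ = C (eval q ℓ) := by
  have hc : ∀ i, pderiv i ℓ = C (coeff 0 (pderiv i ℓ)) :=
    fun i => eq_C_of_isHomogeneous_zero hℓ.pderiv
  have hev : eval q ℓ = ∑ i, coeff 0 (pderiv i ℓ) * q i := by
    conv_lhs => rw [eq_sum_C_mul_X_of_isHomogeneous_one hℓ]
    simp only [map_sum, map_mul, eval_C, eval_X]
  rw [hev, map_sum]
  refine Finset.sum_congr rfl fun i _ => ?_
  rw [mul_comm (coeff 0 _) (q i), C_mul, ← hc i]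

/-! ## §2 The Hessian matrix of the polar conic of a cubic -/

/-- The polar `P_q(F) = Σ qᵢ∂ᵢF` of a form of degree `n` is a form of degree `n − 1`.
[cite: Kunz2005PlaneAlgebraicCurves, Ch. 9, Def. 9.1] -/
theorem isHomogeneous_polar {F : MvPolynomial (Fin m) K} {n : ℕ} (hF : F.IsHomogeneous n)
    (q : Fin m → K) : (∑ i, C (q i) * pderiv i F).IsHomogeneous (n - 1) := by
  refine IsHomogeneous.sum _ _ _ fun i _ => ?_
  have h := (isHomogeneous_C (Fin m) (q i)).mul (hF.pderiv (i := i))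
  simpa using h

/-- **The Hessian matrix of the polar conic of a cubic form is the Hessian matrix of the cubic
evaluated at the pole**: `∂ⱼ∂ₖ(P_q F) = (∂ⱼ∂ₖF)(q)` (constants), i.e. the symmetric bilinear form
of the polar quadric `P_v(F)` is `H(v)(a, b) = F̃(a, b, v)`.
[cite: DolgachevKanev1993, §3 (3.1) ("the matrix of `H(v)` … is equal to `‖∂²F/∂xᵢ∂xⱼ(v)‖`")] -/
theorem hessianMatrix_polar {F : MvPolynomial (Fin m) K} (hF : F.IsHomogeneous 3)
    (q : Fin m → K) :
    hessianMatrix (∑ i, C (q i) * pderiv i F) = ((hessianMatrix F).map (eval q)).map C := by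
  ext j k : 1
  rw [hessianMatrix_apply, Matrix.map_apply, Matrix.map_apply, hessianMatrix_apply]
  have hG : (pderiv j (pderiv k F)).IsHomogeneous 1 := hF.pderiv.pderiv
  rw [← polar_of_isHomogeneous_one hG q, map_sum (pderiv k), map_sum (pderiv j)]
  refine Finset.sum_congr rfl fun i _ => ?_
  rw [pderiv_C_mul, pderiv_C_mul, pderiv_pderiv_comm k i, pderiv_pderiv_comm j i]

/-- **`det Hess(P_q F) = He(F)(q)`**: the discriminant of the polar conic of a cubic is the value
of the Hessian determinant at the pole. [cite: DolgachevKanev1993, §3 (3.1) ("`He(F)(v) = 0 ⇔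
H(v)` is degenerate")] -/
theorem det_hessianMatrix_polar {F : MvPolynomial (Fin m) K} (hF : F.IsHomogeneous 3)
    (q : Fin m → K) :
    (hessianMatrix (∑ i, C (q i) * pderiv i F)).det = C (eval q (hessianMatrix F).det) := by
  rw [hessianMatrix_polar hF q, eval_det_hessianMatrix, RingHom.map_det C, RingHom.mapMatrix_apply]

/-! ## §3 `He(F)` is the locus of poles of singular polar conics -/

/-- **`∇(P_q F)(s) = H_F(q)·s`**: the gradient of the polar conic at `s` is the Hessian matrix of
`F` at the pole applied to `s`. [cite: DolgachevKanev1993, §3, proof of Prop. (3.4)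
("`H(v)(a, x) = P_{v^{n−2},a}(F)(x)`")] -/
theorem grad_polar_eq_mulVec {F : MvPolynomial (Fin m) K} (hF : F.IsHomogeneous 3)
    (q s : Fin m → K) :
    (fun j => eval s (pderiv j (∑ i, C (q i) * pderiv i F))) =
      (hessianMatrix F).map (eval q) *ᵥ s := by
  have h := hessianMatrix_map_eval_mulVec_self (isHomogeneous_polar hF q) s
  rw [hessianMatrix_polar hF q] at h
  have e : (((hessianMatrix F).map (eval q)).map C).map (eval s) =
      (hessianMatrix F).map (eval q) := by
    ext j k : 1
    simp
  rw [e] at h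
  rw [h]
  simp

/-- **Dolgachev–Kanev (3.4) (i) ⇔ (iii) for a cubic / Artebani–Dolgachev: "the Hessian curve
`He(E)` of a plane cubic `E` coincides with the locus of points `q` such that the polar conic
`P_q(E) = 0` is reducible [singular]"** — over every field: `He(F)(q) = 0` if and only if the
polar conic `P_q(F) = Σ qᵢ∂ᵢF` has a singular point, i.e. a `s ≠ 0` at which its gradient
vanishes. [cite: DolgachevKanev1993, §3, Prop. (3.4) (i) ⇔ (iii)]
[cite: ArtebaniDolgachev2009, §3 (`He(E)` is the locus of `q` with `P_q(E)` reducible)] -/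
theorem eval_det_hessianMatrix_eq_zero_iff_polar_singular {F : MvPolynomial (Fin m) K}
    (hF : F.IsHomogeneous 3) (q : Fin m → K) :
    eval q (hessianMatrix F).det = 0 ↔
      ∃ s : Fin m → K, s ≠ 0 ∧ (fun j => eval s (pderiv j (∑ i, C (q i) * pderiv i F))) = 0 := by
  rw [eval_det_hessianMatrix, ← Matrix.exists_mulVec_eq_zero_iff]
  simp only [grad_polar_eq_mulVec hF, ne_eq]

/-- A singular point of the polar conic lies on it when `2 ≠ 0`: `2·P_qF(s) = ⟨s, ∇P_qF(s)⟩`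
(Euler's formula for the conic). [cite: DolgachevKanev1993, §3, Lemma (3.3) (i) ⇔ (ii)] -/
theorem eval_polar_of_grad_eq_zero {F : MvPolynomial (Fin m) K} (hF : F.IsHomogeneous 3)
    (h2 : (2 : K) ≠ 0) {q s : Fin m → K}
    (hs : (fun j => eval s (pderiv j (∑ i, C (q i) * pderiv i F))) = 0) :
    eval s (∑ i, C (q i) * pderiv i F) = 0 := by
  have h := dotProduct_eval_pderiv (isHomogeneous_polar hF q) s
  rw [hs, dotProduct_zero] at h
  have h' : (2 : K) * eval s (∑ i, C (q i) * pderiv i F) = 0 := by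
    simpa using h.symm
  exact (mul_eq_zero.1 h').resolve_left h2

/-- **(5.2.1) "The Steiner correspondence of a cubic is symmetric: `b ∈ Sing(P_a(F)) ⇔
a ∈ Sing(P_b(F))`"** — indeed `∇(P_a F)(b) = ∇(P_b F)(a)` (`= H_F(a)·b`, whose `j`-th entry
`Σₖ (∂ⱼ∂ₖF)(a) bₖ` is `∂ⱼ(P_b F)(a)`). [cite: DolgachevKanev1993, (5.2.1)] -/
theorem grad_polar_comm {F : MvPolynomial (Fin m) K} (hF : F.IsHomogeneous 3) (a b : Fin m → K) :
    (fun j => eval b (pderiv j (∑ i, C (a i) * pderiv i F))) =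
      fun j => eval a (pderiv j (∑ i, C (b i) * pderiv i F)) := by
  rw [grad_polar_eq_mulVec hF a b]
  funext j
  simp only [Matrix.mulVec, dotProduct, Matrix.map_apply, hessianMatrix_apply, map_sum,
    pderiv_C_mul, map_mul, eval_C]
  exact Finset.sum_congr rfl fun k _ => mul_comm _ _

/-- **`∇(P_v F)(v) = 2∇F(v)`** (`= H_F(v)·v`, Euler): the pole is a singular point of its own
polar conic iff it is a singular point of the cubic — Dolgachev–Kanev (3.3) (i) ⇔ (v), whence "the
Steiner correspondence has no united points iff `F` is non-singular".
[cite: DolgachevKanev1993, §3, Lemma (3.3) (i) ⇔ (v); (5.2.1)] -/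
theorem grad_polar_self {F : MvPolynomial (Fin m) K} (hF : F.IsHomogeneous 3) (v : Fin m → K) :
    (fun j => eval v (pderiv j (∑ i, C (v i) * pderiv i F))) =
      (2 : K) • fun j => eval v (pderiv j F) := by
  rw [grad_polar_eq_mulVec hF v v, hessianMatrix_map_eval_mulVec_self hF v]
  norm_num

/-- Dolgachev–Kanev (3.3) (i) ⇔ (v) for a cubic over a field with `2 ≠ 0`: `v` is a singular
point of `P_v(F)` iff `∇F(v) = 0`. [cite: DolgachevKanev1993, §3, Lemma (3.3)] -/
theorem grad_polar_self_eq_zero_iff {F : MvPolynomial (Fin m) K} (hF : F.IsHomogeneous 3)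
    (h2 : (2 : K) ≠ 0) (v : Fin m → K) :
    (fun j => eval v (pderiv j (∑ i, C (v i) * pderiv i F))) = 0 ↔
      (fun j => eval v (pderiv j F)) = 0 := by
  rw [grad_polar_self hF v, smul_eq_zero, or_iff_right h2]

/-! ## §4 Reducible polar conics -/

/-- The Hessian matrix of a product of two linear forms with (constant) gradients `a`, `b` is
`a bᵀ + b aᵀ`. [cite: DolgachevKanev1993, §3 (3.1) (the Hessian of a quadric)] -/
theorem hessianMatrix_mul_of_grad_eq_C {ℓ₁ ℓ₂ : MvPolynomial (Fin m) K} {a b : Fin m → K}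
    (ha : ∀ i, pderiv i ℓ₁ = C (a i)) (hb : ∀ i, pderiv i ℓ₂ = C (b i)) :
    hessianMatrix (ℓ₁ * ℓ₂) = (Matrix.of fun j k => a j * b k + b j * a k).map C := by
  ext j k : 1
  rw [hessianMatrix_apply, Matrix.map_apply, Matrix.of_apply, pderiv_mul, ha k, hb k, map_add,
    pderiv_C_mul, pderiv_mul, pderiv_C, hb j, ha j, map_add, map_mul, map_mul]
  ring

/-- `det (a bᵀ + b aᵀ) = 0` for `3 × 3` matrices (rank `≤ 2`). [folklore] -/
private theorem det_outer_add_outer_eq_zero (a b : Fin 3 → K) :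
    (Matrix.of fun j k => a j * b k + b j * a k).det = 0 := by
  rw [Matrix.det_fin_three]
  simp only [Matrix.of_apply]
  ring

/-- The Hessian determinant of a pair of lines vanishes identically (ternary case).
[cite: DolgachevKanev1993, §3 (3.1) and (5.4) ("Its Hessian is a cubic curve or the whole plane")] -/
theorem det_hessianMatrix_mul_linear {ℓ₁ ℓ₂ : MvPolynomial (Fin 3) K} (h₁ : ℓ₁.IsHomogeneous 1)
    (h₂ : ℓ₂.IsHomogeneous 1) : (hessianMatrix (ℓ₁ * ℓ₂)).det = 0 := by
  have ha : ∀ i, pderiv i ℓ₁ = C (coeff 0 (pderiv i ℓ₁)) :=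
    fun i => eq_C_of_isHomogeneous_zero h₁.pderiv
  have hb : ∀ i, pderiv i ℓ₂ = C (coeff 0 (pderiv i ℓ₂)) :=
    fun i => eq_C_of_isHomogeneous_zero h₂.pderiv
  rw [hessianMatrix_mul_of_grad_eq_C ha hb, ← RingHom.mapMatrix_apply, ← RingHom.map_det,
    det_outer_add_outer_eq_zero, map_zero]

/-- **"Reducible ⟹ on the Hessian"**: if the polar conic `P_q(F)` of a ternary cubic form splits
as a product of two linear forms, then `He(F)(q) = 0` (over every field; the direction of
Artebani–Dolgachev's "reducible" formulation that needs no algebraic closure).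
[cite: ArtebaniDolgachev2009, §3 (`He(E)` is the locus of `q` with `P_q(E)` reducible)]
[cite: DolgachevKanev1993, §3, Prop. (3.4)] -/
theorem eval_det_hessianMatrix_eq_zero_of_polar_reducible {F : MvPolynomial (Fin 3) K}
    (hF : F.IsHomogeneous 3) {q : Fin 3 → K} {ℓ₁ ℓ₂ : MvPolynomial (Fin 3) K}
    (h₁ : ℓ₁.IsHomogeneous 1) (h₂ : ℓ₂.IsHomogeneous 1)
    (h : ∑ i, C (q i) * pderiv i F = ℓ₁ * ℓ₂) : eval q (hessianMatrix F).det = 0 := by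
  have hdet := det_hessianMatrix_polar hF q
  rw [h, det_hessianMatrix_mul_linear h₁ h₂] at hdet
  exact C_eq_zero.1 hdet.symm

/-! ## §5 The polar conics of the Hesse pencil -/

/-- Derivations kill numerals (`no_index` so that `simp` matches literals). [folklore] -/
private theorem pderiv_ofNat_pc (i : Fin 3) (n : ℕ) [n.AtLeastTwo] :
    pderiv i (no_index (OfNat.ofNat n : MvPolynomial (Fin 3) K)) = 0 := by
  rw [← map_ofNat (C : K →+* MvPolynomial (Fin 3) K) n, pderiv_C]

/-- The partial derivatives of `H_μ`. [folklore] -/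
private theorem pderiv_hesse_pc (μ : K) :
    (pderiv 0 𝐇[μ] = C 3 * X 0 ^ 2 - C (3 * μ) * (X 1 * X 2)) ∧
    (pderiv 1 𝐇[μ] = C 3 * X 1 ^ 2 - C (3 * μ) * (X 0 * X 2)) ∧
    (pderiv 2 𝐇[μ] = C 3 * X 2 ^ 2 - C (3 * μ) * (X 0 * X 1)) := by
  refine ⟨?_, ?_, ?_⟩ <;> simp [pderiv_X, pderiv_ofNat_pc, map_ofNat, mul_comm]

/-- `H_μ` is a cubic form. [cite: ArtebaniDolgachev2009, §2 (the Hesse pencil of plane cubic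
curves)] -/
theorem hesse_isHomogeneous (μ : K) : (𝐇[μ] : MvPolynomial (Fin 3) K).IsHomogeneous 3 := by
  refine ((((isHomogeneous_X K 0).pow 3).add ((isHomogeneous_X K 1).pow 3)).add
    ((isHomogeneous_X K 2).pow 3)).sub ?_
  have h := ((isHomogeneous_C (Fin 3) (3 * μ)).mul
    (((isHomogeneous_X K 0).mul (isHomogeneous_X K 1)).mul (isHomogeneous_X K 2)))
  simpa using h

/-- **The polar conic of a point `q = (u, v, w)` with respect to `H_μ`**:
`P_q(H_μ) = 3[u(X² − μYZ) + v(Y² − μXZ) + w(Z² − μXY)]` — the printed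
`u(x² + 2μ′yz) + v(y² + 2μ′xz) + w(z² + 2μ′xy)` of `E_{6μ′}` at `6μ′ = −3μ`.
[cite: ArtebaniDolgachev2009, §3 (the polar conic `P_q(E_{6μ})`)] -/
theorem hesse_polar (μ : K) (q : Fin 3 → K) :
    ∑ i, C (q i) * pderiv i 𝐇[μ] =
      C 3 * (C (q 0) * (X 0 ^ 2 - C μ * (X 1 * X 2)) + C (q 1) * (X 1 ^ 2 - C μ * (X 0 * X 2)) +
        C (q 2) * (X 2 ^ 2 - C μ * (X 0 * X 1))) := by
  obtain ⟨d0, d1, d2⟩ := pderiv_hesse_pc μ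
  rw [Fin.sum_univ_three, d0, d1, d2, map_mul]
  ring

/-- **The symmetric matrix of the polar conic** of `q = (u, v, w)` with respect to `H_μ`: its
Hessian matrix is `[[6u, −3μw, −3μv], [−3μw, 6v, −3μu], [−3μv, −3μu, 6w]]` — six times the printed
`[[u, 2μ′w, 2μ′v], [2μ′w, v, 2μ′u], [2μ′v, 2μ′u, w]]` (`2μ′ = −μ`).
[cite: ArtebaniDolgachev2009, §3 (the matrix of the polar conic, proof of Prop. 3.3)] -/
theorem hessianMatrix_hesse_polar (μ : K) (q : Fin 3 → K) :
    hessianMatrix (∑ i, C (q i) * pderiv i 𝐇[μ]) =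
      (Matrix.of ![![6 * q 0, -(3 * μ * q 2), -(3 * μ * q 1)],
        ![-(3 * μ * q 2), 6 * q 1, -(3 * μ * q 0)],
        ![-(3 * μ * q 1), -(3 * μ * q 0), 6 * q 2]]).map C := by
  rw [hessianMatrix_polar (hesse_isHomogeneous μ) q, hessianMatrix_hesse]
  congr 1
  ext i j : 1
  fin_cases i <;> fin_cases j <;> simp [map_ofNat]

/-- **The discriminant of the polar conic of `q` is `He(H_μ)(q)`**:
`det Hess(P_q H_μ) = −54μ²(u³ + v³ + w³) + (216 − 54μ³)uvw` — the value at `q` of the Hessian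
member of the pencil (`HessePencilHessian.det_hessianMatrix_hesse`).
[cite: ArtebaniDolgachev2009, §3 (`He(E)` and the polar conics; formula (hes))]
[cite: DolgachevKanev1993, (5.4.2) (the Hessian of the Hesse form)] -/
theorem det_hessianMatrix_hesse_polar (μ : K) (q : Fin 3 → K) :
    (hessianMatrix (∑ i, C (q i) * pderiv i 𝐇[μ])).det =
      C (-(54 * μ ^ 2) * (q 0 ^ 3 + q 1 ^ 3 + q 2 ^ 3) + (216 - 54 * μ ^ 3) * (q 0 * q 1 * q 2)) := by
  rw [det_hessianMatrix_polar (hesse_isHomogeneous μ), det_hessianMatrix_hesse]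
  congr 1
  simp

/-- **The polar conic of `q` with respect to `H_μ` is singular iff `q` lies on the Hessian curve
`He(H_μ) = −54μ²(X³ + Y³ + Z³) + (216 − 54μ³)XYZ`** (a member of the pencil), over every field.
[cite: ArtebaniDolgachev2009, §3 (`He(E)` is the locus of poles of reducible polar conics)]
[cite: DolgachevKanev1993, §3, Prop. (3.4)] -/
theorem hesse_polar_singular_iff (μ : K) (q : Fin 3 → K) :
    (∃ s : Fin 3 → K, s ≠ 0 ∧ (fun j => eval s (pderiv j (∑ i, C (q i) * pderiv i 𝐇[μ]))) = 0) ↔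
      -(54 * μ ^ 2) * (q 0 ^ 3 + q 1 ^ 3 + q 2 ^ 3) + (216 - 54 * μ ^ 3) * (q 0 * q 1 * q 2) = 0 := by
  rw [← eval_det_hessianMatrix_eq_zero_iff_polar_singular (hesse_isHomogeneous μ),
    det_hessianMatrix_hesse]
  simp

end PolarConic

end Literature.AlgebraicGeometry.PlaneCurves
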